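import Literature.NumberTheory.Sieve.FriedlanderIwaniecPrimesUdSeparable
import HarnessLib

/-!
# Friedlander–Iwaniec, *The polynomial `X² + Y⁴` captures its primes*, §16 (16.11)–(16.14) applied to the separated
# block: `S_d^0(k) = Φ(d)⁻¹ Σ_χ 𝒥(χ) |S_χ^k(β)|²`

Source: J. Friedlander, H. Iwaniec, Ann. of Math. (2) 148 (1998), 945–1040 [FriedlanderIwaniecAnnals1998]
(= arXiv:math/9811185), §16 pp. 59–60:

> "Now we detect the congruence (16.3) by multiplicative characters of the group `(ℤ[i]/4dℤ[i])^*` getting (16.11)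
> `Σ_ω (ω/d) ΣΣ_{z₁ ≡ ω z₂} β_{z₁} β̄_{z₂} (z₁z̄₂/|z₁z₂|)^k = Φ(d)⁻¹ Σ_χ 𝒥(χ) |S_χ^k(β)|²` where `Φ(d)` is the order of
> the group … and where (16.13) `𝒥(χ) = Σ_{ω (mod 4d)} χ(ω) (ω/d)` … For every such `χ` in (16.11) we have the
> character sum (16.14) `S_χ^k(β) = Σ_z β_z χ(z) (z/|z|)^k`. Inserting (16.11) in (16.10) and the latter in (16.1) we
> arrive at the formula (16.15)."

The detection identity itself is the tree's `sum_sum_dvd_im_conj_eq_sum_mulChar` (`…CharacterDetection`, for any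
modulus `q`, any `q`-periodic weight `F` on the rational classes and any coefficients).  This file applies it to the
separated block `fiSd0 d S b k` of `…UdSeparable` ((16.10) for the printed main term of (16.6)): with `q = 4d`,
`F(ω) = (ω/d')` (`d'` the odd part of `d`, the tree's `fiChi`) and `c_k(z) = β_z (z/|z|)^k`,

* `fiSd0_eq_sum_mulChar` — **(16.11) for the block**:
  `S_d^0(k) = Φ⁻¹ Σ_χ 𝒥(χ) · |Σ_{z ∈ S} β_z (z/|z|)^k χ(z)|²`, `Φ = #(ℤ[i]/4dℤ[i])ˣ`,
  `𝒥(χ) = Σ_{0 ≤ ω < 4d} (ω/d') χ(ω)`, for supports `S` whose norms are prime to `4d` (in the source `(z z̄, Π) = 1`,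
  `P > 4d`); the only inputs beyond the detection identity are the antisymmetry `Δ(z₂,z₁) = -Δ(z₁,z₂)`, the
  `4d`-periodicity of `(ω/d')`, and the hermitian shape of the harmonic (`harmonic_pair_eq`).

Combined with `fiU_eq_sum_fiUd`, `abs_fiUd_sub_fiUdMoll_le`, `abs_fiUdMoll_sub_fiUd0_le`, `exists_fiUd0_trunc`
(`…UdDecomposition`, `…UdSeparable`) this is the formula (16.15) up to the three explicitly bounded finite sums of
discarded pairs.  No named facts, no `sorry`.

## References
* J. Friedlander, H. Iwaniec, Ann. of Math. (2) 148 (1998), 945–1040, §16 (16.11)–(16.15). [FriedlanderIwaniecAnnals1998]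

## Tree / Mathlib
Tree: `sum_sum_dvd_im_conj_eq_sum_mulChar`, `GaussQuot`, `toQuot`, `ratioClass`, `im_star_mul`
(`…CharacterDetection`), `fiSd0`, `harmonic_pair_eq` (`…UdSeparable`), `fiChi`, `fiDelta` (`…MainTermSplit`).
Mathlib: `jacobiSym.mod_left'`, `Int.emod_emod_of_dvd`, `Finset.sum_comm`.
-/

noncomputable section

open Real Complex Finset
open scoped ComplexConjugate NumberTheorySymbols

namespace Literature.NumberTheory.Sieve.FriedlanderIwaniecPrimes

/-- `Δ(z₂, z₁) = -Δ(z₁, z₂)`. [cite: FriedlanderIwaniecAnnals1998, (6.1)] -/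
theorem fiDelta_swap (z₁ z₂ : GaussianInt) : fiDelta z₂ z₁ = -fiDelta z₁ z₂ := by
  unfold fiDelta; rw [im_star_mul, im_star_mul]; ring

/-- `(ω/d')` is `4d`-periodic in `ω` (`d' ∣ d ∣ 4d`). [cite: FriedlanderIwaniecAnnals1998, (16.13) (`ω (mod 4d)`)] -/
theorem jacobiSym_oddPart_periodic (d : ℕ) {ω ω' : ℤ} (h : ((4 * d : ℕ) : ℤ) ∣ ω - ω') :
    J(ω | d / 2 ^ d.factorization 2) = J(ω' | d / 2 ^ d.factorization 2) := by
  set d' := d / 2 ^ d.factorization 2 with hd'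
  have hd'd : (d' : ℤ) ∣ ((4 * d : ℕ) : ℤ) := by
    have h1 : d' ∣ d := Nat.ordCompl_dvd d 2
    exact_mod_cast h1.trans (Dvd.intro_left 4 rfl)
  have hω : (d' : ℤ) ∣ ω - ω' := hd'd.trans h
  refine jacobiSym.mod_left' ?_
  have := (Int.modEq_iff_dvd.mpr (show (d' : ℤ) ∣ ω - ω' from hω)).symm
  exact this

/-- **(16.11) for the separated block** (`q = 4d`, norms of the support prime to `4d`):
`S_d^0(k) = Φ⁻¹ Σ_χ 𝒥(χ) |Σ_{z ∈ S} β_z (z/|z|)^k χ(z)|²` with `Φ = #(ℤ[i]/4dℤ[i])ˣ` ((16.12)),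
`𝒥(χ) = Σ_{ω (mod 4d)} (ω/d') χ(ω)` ((16.13)) and the character sums `S_χ^k(β) = Σ_z β_z χ(z)(z/|z|)^k` ((16.14)).
[cite: FriedlanderIwaniecAnnals1998, (16.11)–(16.14)] -/
theorem fiSd0_eq_sum_mulChar (q d : ℕ) [NeZero q] (hq : q = 4 * d) (S : Finset GaussianInt)
    (hS : ∀ z ∈ S, Nat.Coprime z.norm.natAbs q) (b : GaussianInt → ℝ) (k : ℤ) :
    fiSd0 d S b k =
      (Fintype.card (GaussQuot q)ˣ : ℂ)⁻¹ * ∑ χ : MulChar (GaussQuot q) ℂ,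
        (∑ ω ∈ range q, (J(ω | d / 2 ^ d.factorization 2) : ℂ) * χ (toQuot q (ω : GaussianInt))) *
          ((‖∑ z ∈ S, (b z : ℂ) * (GaussianInt.toComplex z / (‖GaussianInt.toComplex z‖ : ℂ)) ^ k *
              χ (toQuot q z)‖ ^ 2 : ℝ) : ℂ) := by
  set F : ℤ → ℂ := fun ω => (J(ω | d / 2 ^ d.factorization 2) : ℂ) with hF
  set cf : GaussianInt → ℂ := fun z =>
    (b z : ℂ) * (GaussianInt.toComplex z / (‖GaussianInt.toComplex z‖ : ℂ)) ^ k with hcf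
  have hFper : ∀ ω ω' : ℤ, (q : ℤ) ∣ ω - ω' → F ω = F ω' := by
    intro ω ω' h
    simp only [hF]
    rw [jacobiSym_oddPart_periodic d (by rw [← hq]; exact h)]
  have hdet := sum_sum_dvd_im_conj_eq_sum_mulChar S hS F hFper cf
  -- rewrite the block into the input shape of the detection identity
  have hperm : fiSd0 d S b k = ∑ z₁ ∈ S, ∑ z₂ ∈ S,
      (if (q : ℤ) ∣ (star z₁ * z₂).im then F (ratioClass q z₁ z₂) * (starRingEnd ℂ (cf z₁) * cf z₂) else 0) := by
    unfold fiSd0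
    rw [Finset.sum_comm]
    refine sum_congr rfl fun a _ => sum_congr rfl fun c _ => ?_
    have hdiv : (4 * (d : ℤ)) ∣ fiDelta c a ↔ (q : ℤ) ∣ (star a * c).im := by
      rw [fiDelta_swap a c, dvd_neg, hq]; push_cast; rfl
    by_cases h : (q : ℤ) ∣ (star a * c).im
    · rw [if_pos (hdiv.mpr h), if_pos h]
      simp only [hF, hcf, fiChi, hq, map_mul, Complex.conj_ofReal, harmonic_pair_eq]
      push_cast
      ring
    · rw [if_neg (fun h' => h (hdiv.mp h')), if_neg h]
  rw [hperm, hdet]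

end Literature.NumberTheory.Sieve.FriedlanderIwaniecPrimes
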